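import Summits.CriticalPhenomena.PercolationContinuityZ3.Theorems.Transplant.SkelFrmBParamsFaceBandA
import Summits.CriticalPhenomena.PercolationContinuityZ3.Theorems.Transplant.SkelFrmBParamsFaceUnits
import Summits.CriticalPhenomena.PercolationContinuityZ3.Theorems.Transplant.SkelFrmBParamsExcess
import Summits.CriticalPhenomena.PercolationContinuityZ3.Theorems.Transplant.SkelFrmBParamsSlotsTA
import Summits.CriticalPhenomena.PercolationContinuityZ3.Theorems.Transplant.SkelPhiFaceNumsXRun
import Summits.CriticalPhenomena.PercolationContinuityZ3.Theorems.Transplant.SkelNegBParamsFaceFloorsTXA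
import Summits.CriticalPhenomena.PercolationContinuityZ3.Theorems.Transplant.SkelNegBParamsRootArith
import HarnessLib

/-!
# N2 (frames-only node `SamePDropOfSkeletonFrm₁`, OPEN) params column over `PlanarSkeletonFrm` — (ζ″) ledger, shape (B′) of record ((R-14)):
# MECHANICAL PORT of N1's `SkelNegBParamsFaceFloorsTXA` — M3 (the (F) per-centre floors at the (ζ′) tuple), group G-X part T — **THE x-FACE ALONG RUN's TRANSVERSE FLOORS
# `FX5`/`FX6`** (fields `FloorsX2.FX5/FX6` of `Skelφ.numsX_provider₂`, SkelPhiFaceNumsXP2 :53–:56) at M3-FLOORS-SIGNATURE §1: `pr := prFA` (`coarse c₁ (D/2) D (lam1 A n_L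
# h_L yL) = KS.F1cA … (N1 title abridged; see `SkelNegBParamsFaceFloorsTXA`)
builds on p205010 (kernel theorem, internal audit signed; external expert review pending) — nothing in this file uses p205010; NOTHING is claimed about the
open node `SamePDropOfSkeletonFrm₁` (`SamePDropOfSkeletonNeg₁` is CLOSED in the tree and untouched by this file).
Status sentence (coordinator 2026-08-20T04:30Z): "θ(p_c) = 0 on ℤ^d, all d ≥ 2 — kernel-verified (Lean 4/Mathlib, standard axioms); internal adversarial
audit SIGNED 2026-08-20 04:29Z; external expert review pending."
Lane `prim-bschramm-*`, seat `prim-bschramm-p1` (gen 17; (F) value layer, lead g11 06:35:07Z) running stmt-g19's port tool of record; helper file (`--supports stmt-CriticalPhenomena-4575 --as helper`); ledger HOME/prim-bschramm-stmt/FRM-PARAMS.md §9, (R-14).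
PORT RULES (HOME/prim-bschramm-stmt-g19/lean/port_frm.py, the tool of record per (R-14)): outer namespace `PlanarSkeletonNeg ↦ PlanarSkeletonFrm`, carrier binder
`(Φ : PlanarSkeletonFrm G)`, record binder `(D : Skelφ.StepI.DataNS V)` (the selectors travel IN the record, `SkelPhiStepIDataNS`); section variables INLINED into every
declaration header; inner namespaces (`Neg`/`NegB`/`KS`/…) and every short name KEPT so all cross-references resolve unchanged; declarations using no section variable are
NOT re-declared (N1's originals are referenced fully qualified). Mathematical content, proofs, docstrings and citations are N1's, verbatim, except where stated next.
RE-HOMED IN §0: `KS.Wrun/Lbrun/Wrun_spec` (N1 part RootVals §Boxes — cell-free window sizes of the x-run). SELECTORS IN THIS FILE ((R-14) condition of record — joint selection, `D.sN`'s first argument is the literal handed to `D.sM`): none (pure port; the pairs are read through their N1 names).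
N1 HEADER (kept for the reader):
helper file (`--supports stmt-CriticalPhenomena-4575 --as helper`); slot-ledger ζ′ v1.
[cite: KozmaNitzan2024, §4 Lemma 12 (pp. 23–25)] [cite: MartineauTassion2017, §4.1]
-/

noncomputable section

open scoped Classical

namespace Summit.CriticalPhenomena.PercolationContinuityZ3.Theorems.Transplant

namespace PlanarSkeletonFrm

namespace NegB

open Literature.Probability.Percolation Literature.Probability.LatticeModels SimpleGraph
open SkelConc (Consts)
open Skelφ (shearUnit xBoxB)
open Skelφ.StepI (DataN)
open TwoAxis.Para (modulus)
open Neg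

namespace KS

section RunBox

/-! ## §0 The x-run's window sizes (re-homed from N1 part RootVals §Boxes :50–:53/:74 — cell-free; the rest of §Boxes is retired run-from-the-root geometry) -/

/-- The window half-width `W := n_Lℓ_L/U + 1` of the x-run (`xPrmW`'s `Wp = Wm`; p5's `kgP`). [this work] -/
def Wrun (κ : Consts) {V : Type} [DecidableEq V] [Countable V] {G : SimpleGraph V} [G.LocallyFinite] (Φ : PlanarSkeletonFrm G) (t : V) (p : unitInterval) (D : Skelφ.StepI.DataNS V) (g : ℕ) (f : ℕ) : ℕ := nL κ Φ t p D g f * ℓL κ Φ t p D g f / shearUnit (nL κ Φ t p D g f) (hL κ Φ t p D g f) + 1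

/-- The link box's transverse half-size `Lb := 3n_Lℓ_L/U + 1`. [this work] -/
def Lbrun (κ : Consts) {V : Type} [DecidableEq V] [Countable V] {G : SimpleGraph V} [G.LocallyFinite] (Φ : PlanarSkeletonFrm G) (t : V) (p : unitInterval) (D : Skelφ.StepI.DataNS V) (g : ℕ) (f : ℕ) : ℕ := 3 * (nL κ Φ t p D g f * ℓL κ Φ t p D g f) / shearUnit (nL κ Φ t p D g f) (hL κ Φ t p D g f) + 1

/-- `U·W ≤ n_Lℓ_L + U` and `U·Lb ≤ 3n_Lℓ_L + U` (floor division). [folklore] -/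
theorem Wrun_spec (κ : Consts) {V : Type} [DecidableEq V] [Countable V] {G : SimpleGraph V} [G.LocallyFinite] (Φ : PlanarSkeletonFrm G) (t : V) (p : unitInterval) (D : Skelφ.StepI.DataNS V) (g : ℕ) (f : ℕ) (hn : 1 ≤ nL κ Φ t p D g f) :
    (shearUnit (nL κ Φ t p D g f) (hL κ Φ t p D g f) : ℤ) * (Wrun κ Φ t p D g f : ℤ) ≤ (nL κ Φ t p D g f : ℤ) * ℓL κ Φ t p D g f + shearUnit (nL κ Φ t p D g f) (hL κ Φ t p D g f) ∧
      (shearUnit (nL κ Φ t p D g f) (hL κ Φ t p D g f) : ℤ) * (Lbrun κ Φ t p D g f : ℤ) ≤ 3 * ((nL κ Φ t p D g f : ℤ) * ℓL κ Φ t p D g f) + shearUnit (nL κ Φ t p D g f) (hL κ Φ t p D g f) := by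
  have hU : 0 < shearUnit (nL κ Φ t p D g f) (hL κ Φ t p D g f) := by unfold Skelφ.shearUnit; omega
  have h1 := Nat.div_mul_le_self (nL κ Φ t p D g f * ℓL κ Φ t p D g f) (shearUnit (nL κ Φ t p D g f) (hL κ Φ t p D g f))
  have h2 := Nat.div_mul_le_self (3 * (nL κ Φ t p D g f * ℓL κ Φ t p D g f)) (shearUnit (nL κ Φ t p D g f) (hL κ Φ t p D g f))
  unfold Wrun Lbrun
  constructor
  · push_cast; nlinarith
  · push_cast; nlinarith

end RunBox

section FloorsTX

/-- `xBoxB n_L ℓ_L h_L R′ k = W + k·R′ + R′ + Lb` with part RootVals' `Wrun`/`Lbrun`. [folklore] -/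
theorem xBoxB_eq (κ : Consts) {V : Type} [DecidableEq V] [Countable V] {G : SimpleGraph V} [G.LocallyFinite] (Φ : PlanarSkeletonFrm G) (t : V) (p : unitInterval) (D : Skelφ.StepI.DataNS V) (g : ℕ) (f : ℕ) (R' k : ℕ) : xBoxB (nL κ Φ t p D g f) (ℓL κ Φ t p D g f) (hL κ Φ t p D g f) R' k =
    (Wrun κ Φ t p D g f : ℤ) + (k : ℤ) * R' + R' + (Lbrun κ Φ t p D g f : ℤ) := by
  unfold Skelφ.xBoxB Wrun Lbrun; push_cast; ring

/-- **The slant size of region `k`**: `2·u₁·(U·(xBoxB k + 1)) ≤ 9·u₁·m` whenever `(k+1)·RA′ ≤ 1000·Kq·RA′`-type (`k + 1 ≤ 1000·Kq`), `|h_L| ≤ 10n_L`, `22000·Kq·(RA′+2) ≤ ℓ_L`.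
[folklore] -/
theorem slant_le (κ : Consts) {V : Type} [DecidableEq V] [Countable V] {G : SimpleGraph V} [G.LocallyFinite] (Φ : PlanarSkeletonFrm G) (t : V) (p : unitInterval) (D : Skelφ.StepI.DataNS V) (g : ℕ) (f : ℕ) (mk : ℕ) (hN : EqNumL κ Φ t p D g f) (hκ : (hL κ Φ t p D g f).natAbs ≤ 10 * nL κ Φ t p D g f)
    (hℓ : 22000 * Neg.Kq κ * (RA' κ Φ t p D mk + 2) ≤ ℓL κ Φ t p D g f) {k : ℕ} (hk : k + 1 ≤ 1000 * Neg.Kq κ) {u : ℤ} (hu : 0 ≤ u) :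
    2 * (u * ((shearUnit (nL κ Φ t p D g f) (hL κ Φ t p D g f) : ℤ) * (xBoxB (nL κ Φ t p D g f) (ℓL κ Φ t p D g f) (hL κ Φ t p D g f) (RA' κ Φ t p D mk) k + 1))) ≤
      9 * (u * modulus (nL κ Φ t p D g f) (hL κ Φ t p D g f) (vL κ Φ t p D g f) (vβL κ Φ t p D g f)) := by
  obtain ⟨hn1, hℓ1⟩ := one_le_of_eqNumL κ Φ t p D g f hN
  have hm := (Skelφ.NegPrm.modulus_vβOf hn1 (hL κ Φ t p D g f) (ℓL κ Φ t p D g f) (vL κ Φ t p D g f)).1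
  have e : vβL κ Φ t p D g f = Skelφ.NegPrm.vβOf (nL κ Φ t p D g f) (hL κ Φ t p D g f) (ℓL κ Φ t p D g f) (vL κ Φ t p D g f) := rfl
  rw [← e] at hm
  obtain ⟨hW, hLb⟩ := Wrun_spec κ Φ t p D g f hn1
  have hU0 : (0 : ℤ) ≤ ((hL κ Φ t p D g f).natAbs : ℤ) := Nat.cast_nonneg _
  have h10 : (((hL κ Φ t p D g f).natAbs : ℕ) : ℤ) ≤ 10 * (nL κ Φ t p D g f : ℤ) := by exact_mod_cast hκ
  have hUe : (shearUnit (nL κ Φ t p D g f) (hL κ Φ t p D g f) : ℤ) = (nL κ Φ t p D g f : ℤ) + ((hL κ Φ t p D g f).natAbs : ℤ) := by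
    unfold Skelφ.shearUnit; push_cast; ring
  have hℓ' : 22000 * (Neg.Kq κ : ℤ) * ((RA' κ Φ t p D mk : ℤ) + 2) ≤ (ℓL κ Φ t p D g f : ℤ) := by exact_mod_cast hℓ
  have hk' : (k : ℤ) + 1 ≤ 1000 * (Neg.Kq κ : ℤ) := by exact_mod_cast hk
  clear hℓ hk hκ
  have hR0 : (0 : ℤ) ≤ (RA' κ Φ t p D mk : ℤ) := Nat.cast_nonneg _
  have hq : (1 : ℤ) ≤ (Neg.Kq κ : ℤ) := by exact_mod_cast Neg.one_le_Kq κ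
  have hn : (1 : ℤ) ≤ (nL κ Φ t p D g f : ℤ) := by exact_mod_cast hn1
  rw [xBoxB_eq]
  set U : ℤ := (shearUnit (nL κ Φ t p D g f) (hL κ Φ t p D g f) : ℤ)
  set n : ℤ := (nL κ Φ t p D g f : ℤ)
  set ℓ : ℤ := (ℓL κ Φ t p D g f : ℤ)
  set m := modulus (nL κ Φ t p D g f) (hL κ Φ t p D g f) (vL κ Φ t p D g f) (vβL κ Φ t p D g f)
  set R : ℤ := (RA' κ Φ t p D mk : ℤ)
  set Q : ℤ := (Neg.Kq κ : ℤ)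
  set W : ℤ := (Wrun κ Φ t p D g f : ℤ)
  set Lb : ℤ := (Lbrun κ Φ t p D g f : ℤ)
  have hU11 : U ≤ 11 * n := by rw [hUe]; linarith
  have hU1 : 0 ≤ U := by rw [hUe]; linarith
  -- `U·(W + kR + R + Lb + 1) ≤ 4nℓ + 3U + (k+1)·R·U`
  have hkR : ((k : ℤ) + 1) * R ≤ 1000 * Q * R := mul_le_mul_of_nonneg_right hk' hR0
  have hURk : U * (((k : ℤ) + 1) * R) ≤ (11 * n) * (1000 * Q * R) := mul_le_mul hU11 hkR (mul_nonneg (by linarith) hR0) (by linarith)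
  have hQR : (0 : ℤ) ≤ Q * R := mul_nonneg (by linarith) hR0
  have hX : n * (2 * (37 + 11000 * Q * R)) ≤ n * (ℓ - 1) := mul_le_mul_of_nonneg_left (by linarith) (by linarith)
  have hB : U * (W + (k : ℤ) * R + R + Lb + 1) ≤ 4 * (n * ℓ) + 3 * U + 11000 * (n * (Q * R)) := by
    have e1 : U * (W + (k : ℤ) * R + R + Lb + 1) = U * W + U * (((k : ℤ) + 1) * R) + U * Lb + U := by ring
    rw [e1]; nlinarith
  have hB2 : 2 * (U * (W + (k : ℤ) * R + R + Lb + 1)) ≤ 9 * m := by nlinarith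
  have := mul_le_mul_of_nonneg_left hB2 hu
  nlinarith

/-- **`FX5` at the (ζ′) x-face tuple** (`k₀ := 3`, any `k` with `k + 1 ≤ 1000·Kq`): the lower transverse reading of region `k` of the along run is above `−fw`.
[cite: KozmaNitzan2024, §4 Lemma 12 (pp. 23–25)] -/
theorem FX5_XA (κ : Consts) {V : Type} [DecidableEq V] [Countable V] {G : SimpleGraph V} [G.LocallyFinite] (Φ : PlanarSkeletonFrm G) (t : V) (p : unitInterval) (D : Skelφ.StepI.DataNS V) (g : ℕ) (f : ℕ) (mk : ℕ) (hN : EqNumL κ Φ t p D g f) (hκ : (hL κ Φ t p D g f).natAbs ≤ 10 * nL κ Φ t p D g f)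
    (hℓ : 22000 * Neg.Kq κ * (RA' κ Φ t p D mk + 2) ≤ ℓL κ Φ t p D g f) (yL : Site 2)
    (hΛ₁ : |Λ₁of κ Φ t p D g f yL| ≤ 3 * modulus (nL κ Φ t p D g f) (hL κ Φ t p D g f) (vL κ Φ t p D g f) (vβL κ Φ t p D g f))
    (x z : Site 2) (i : Fin 2) (hfw : |z i - (fcellsA κ Φ t p D g f).cen x i| + 8 * u₁A κ Φ t p D g f + 8 ≤ 5 * ((fcellsA κ Φ t p D g f).r i : ℤ))
    {k : ℕ} (hk : k + 1 ≤ 1000 * Neg.Kq κ) :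
    modulus (nL κ Φ t p D g f) (hL κ Φ t p D g f) (vL κ Φ t p D g f) (vβL κ Φ t p D g f) *
        (-(5 * ((fcellsA κ Φ t p D g f).r i : ℤ) - 4 - 3 - |z i - (fcellsA κ Φ t p D g f).cen x i|) - F1cA κ Φ t p D g f yL) ≤
      -(u₁A κ Φ t p D g f * (shearUnit (nL κ Φ t p D g f) (hL κ Φ t p D g f) : ℤ) *
          (xBoxB (nL κ Φ t p D g f) (ℓL κ Φ t p D g f) (hL κ Φ t p D g f) (RA' κ Φ t p D mk) k + 1)) -
        modulus (nL κ Φ t p D g f) (hL κ Φ t p D g f) (vL κ Φ t p D g f) (vβL κ Φ t p D g f) + 1 := by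
  obtain ⟨hn1, hℓ1⟩ := one_le_of_eqNumL κ Φ t p D g f hN
  have hm0 : 0 < modulus (nL κ Φ t p D g f) (hL κ Φ t p D g f) (vL κ Φ t p D g f) (vβL κ Φ t p D g f) := Skelφ.NegPrm.modulus_vβOf_pos hn1 hℓ1 _ _
  have hu : 1 ≤ u₁A κ Φ t p D g f := (units_eqA κ Φ t p D g f).2.2.2.2.2
  have hsl := slant_le κ Φ t p D g f mk hN hκ hℓ hk (by linarith : 0 ≤ u₁A κ Φ t p D g f)
  have hF := F1cA_eq κ Φ t p D g f yL
  obtain ⟨f1, f2⟩ := PlanarSkeletonNeg.NegB.RootArith.floor_sandwich (x := 2 * u₁A κ Φ t p D g f * Λ₁of κ Φ t p D g f yL + modulus (nL κ Φ t p D g f) (hL κ Φ t p D g f) (vL κ Φ t p D g f) (vβL κ Φ t p D g f))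
    (d := 2 * modulus (nL κ Φ t p D g f) (hL κ Φ t p D g f) (vL κ Φ t p D g f) (vβL κ Φ t p D g f)) (by linarith)
  rw [← hF] at f1 f2
  clear hF hℓ hk hκ
  set m := modulus (nL κ Φ t p D g f) (hL κ Φ t p D g f) (vL κ Φ t p D g f) (vβL κ Φ t p D g f)
  set u := u₁A κ Φ t p D g f
  set F := F1cA κ Φ t p D g f yL
  set S := u * ((shearUnit (nL κ Φ t p D g f) (hL κ Φ t p D g f) : ℤ) * (xBoxB (nL κ Φ t p D g f) (ℓL κ Φ t p D g f) (hL κ Φ t p D g f) (RA' κ Φ t p D mk) k + 1))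
  set zc := |z i - (fcellsA κ Φ t p D g f).cen x i|
  obtain ⟨hΛa, hΛb⟩ := abs_le.1 hΛ₁
  have huΛ : u * (-(3 * m)) ≤ u * Λ₁of κ Φ t p D g f yL := mul_le_mul_of_nonneg_left hΛa (by linarith)
  -- `F ≥ −3u`: `2mF > 2uΛ₁ − m ≥ −6um − m`
  have hFlo : -(3 * u) ≤ F := by
    by_contra hc; push Not at hc
    have h1 : 2 * m * F ≤ 2 * m * (-(3 * u) - 1) := mul_le_mul_of_nonneg_left (by linarith) (by linarith)
    nlinarith
  have hmF : m * (-(3 * u)) ≤ m * F := mul_le_mul_of_nonneg_left hFlo hm0.le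
  have hfw' : m * (8 * u + 1) ≤ m * (5 * ((fcellsA κ Φ t p D g f).r i : ℤ) - 7 - zc) := mul_le_mul_of_nonneg_left (by linarith) hm0.le
  nlinarith

/-- **`FX6` at the (ζ′) x-face tuple** (`k₀ := 3`, any `k` with `k + 1 ≤ 1000·Kq`): the upper transverse reading of region `k` of the along run is below `fw`.
[cite: KozmaNitzan2024, §4 Lemma 12 (pp. 23–25)] -/
theorem FX6_XA (κ : Consts) {V : Type} [DecidableEq V] [Countable V] {G : SimpleGraph V} [G.LocallyFinite] (Φ : PlanarSkeletonFrm G) (t : V) (p : unitInterval) (D : Skelφ.StepI.DataNS V) (g : ℕ) (f : ℕ) (mk : ℕ) (hN : EqNumL κ Φ t p D g f) (hκ : (hL κ Φ t p D g f).natAbs ≤ 10 * nL κ Φ t p D g f)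
    (hℓ : 22000 * Neg.Kq κ * (RA' κ Φ t p D mk + 2) ≤ ℓL κ Φ t p D g f) (yL : Site 2)
    (hΛ₁ : |Λ₁of κ Φ t p D g f yL| ≤ 3 * modulus (nL κ Φ t p D g f) (hL κ Φ t p D g f) (vL κ Φ t p D g f) (vβL κ Φ t p D g f))
    (x z : Site 2) (i : Fin 2) (hfw : |z i - (fcellsA κ Φ t p D g f).cen x i| + 8 * u₁A κ Φ t p D g f + 8 ≤ 5 * ((fcellsA κ Φ t p D g f).r i : ℤ))
    {k : ℕ} (hk : k + 1 ≤ 1000 * Neg.Kq κ) :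
    modulus (nL κ Φ t p D g f) (hL κ Φ t p D g f) (vL κ Φ t p D g f) (vβL κ Φ t p D g f) * (F1cA κ Φ t p D g f yL + 1) +
        u₁A κ Φ t p D g f * ((shearUnit (nL κ Φ t p D g f) (hL κ Φ t p D g f) : ℤ) * xBoxB (nL κ Φ t p D g f) (ℓL κ Φ t p D g f) (hL κ Φ t p D g f) (RA' κ Φ t p D mk) k +
          shearUnit (nL κ Φ t p D g f) (hL κ Φ t p D g f) - 1) ≤
      modulus (nL κ Φ t p D g f) (hL κ Φ t p D g f) (vL κ Φ t p D g f) (vβL κ Φ t p D g f) *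
        (5 * ((fcellsA κ Φ t p D g f).r i : ℤ) - 4 - 3 - |z i - (fcellsA κ Φ t p D g f).cen x i|) := by
  obtain ⟨hn1, hℓ1⟩ := one_le_of_eqNumL κ Φ t p D g f hN
  have hm0 : 0 < modulus (nL κ Φ t p D g f) (hL κ Φ t p D g f) (vL κ Φ t p D g f) (vβL κ Φ t p D g f) := Skelφ.NegPrm.modulus_vβOf_pos hn1 hℓ1 _ _
  have hu : 1 ≤ u₁A κ Φ t p D g f := (units_eqA κ Φ t p D g f).2.2.2.2.2
  have hsl := slant_le κ Φ t p D g f mk hN hκ hℓ hk (by linarith : 0 ≤ u₁A κ Φ t p D g f)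
  have hF := F1cA_eq κ Φ t p D g f yL
  obtain ⟨f1, f2⟩ := PlanarSkeletonNeg.NegB.RootArith.floor_sandwich (x := 2 * u₁A κ Φ t p D g f * Λ₁of κ Φ t p D g f yL + modulus (nL κ Φ t p D g f) (hL κ Φ t p D g f) (vL κ Φ t p D g f) (vβL κ Φ t p D g f))
    (d := 2 * modulus (nL κ Φ t p D g f) (hL κ Φ t p D g f) (vL κ Φ t p D g f) (vβL κ Φ t p D g f)) (by linarith)
  rw [← hF] at f1 f2
  clear hF hℓ hk hκ
  set m := modulus (nL κ Φ t p D g f) (hL κ Φ t p D g f) (vL κ Φ t p D g f) (vβL κ Φ t p D g f)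
  set u := u₁A κ Φ t p D g f
  set F := F1cA κ Φ t p D g f yL
  set U : ℤ := (shearUnit (nL κ Φ t p D g f) (hL κ Φ t p D g f) : ℤ)
  set B := xBoxB (nL κ Φ t p D g f) (ℓL κ Φ t p D g f) (hL κ Φ t p D g f) (RA' κ Φ t p D mk) k
  set zc := |z i - (fcellsA κ Φ t p D g f).cen x i|
  obtain ⟨hΛa, hΛb⟩ := abs_le.1 hΛ₁
  have huΛ : u * Λ₁of κ Φ t p D g f yL ≤ u * (3 * m) := mul_le_mul_of_nonneg_left hΛb (by linarith)
  -- `F ≤ 3u`: `2mF ≤ 2uΛ₁ + m ≤ 6um + m`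
  have hFhi : F ≤ 3 * u := by
    by_contra hc; push Not at hc
    have h1 : 2 * m * (3 * u + 1) ≤ 2 * m * F := mul_le_mul_of_nonneg_left (by linarith) (by linarith)
    nlinarith
  have hmF : m * F ≤ m * (3 * u) := mul_le_mul_of_nonneg_left hFhi hm0.le
  have hfw' : m * (8 * u + 1) ≤ m * (5 * ((fcellsA κ Φ t p D g f).r i : ℤ) - 7 - zc) := mul_le_mul_of_nonneg_left (by linarith) hm0.le
  have e : u * (U * B + U - 1) = u * (U * (B + 1)) - u := by ring
  rw [e]
  nlinarith

end FloorsTX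

/-! ## §2 The band room `kFF₂ + 8u + 8 ≤ 5r` serving `hfw` (p1-g13's `hkE_RA` shape with the constant FX5/FX6 need) -/

section Band

/-- **`kFF₂ + 8·u + 8 ≤ 5·r_(oth I)`** at `g := gT`, every `Rl ≤ RA′`, both axes (`kFF₂ ≤ 2r + 5Rl + 15`, `r = 40Kq·u`, `u ≥ 6RA′ + 11`): with the band
hypothesis `|z⊥ − cen⊥| ≤ kFF₂` this is `hfw` of `FX5_XA/FX6_XA`. [cite: KozmaNitzan2024, §4 Lemma 12 (pp. 23–25)] -/
theorem hkE8_RA (κ : Consts) {V : Type} [DecidableEq V] [Countable V] {G : SimpleGraph V} [G.LocallyFinite] (Φ : PlanarSkeletonFrm G) (t : V) (p : unitInterval) (D : Skelφ.StepI.DataNS V) (f : ℕ) (mk : ℕ) (gx : Neg.FSlot) (hN : EqNumL κ Φ t p D (gT mk gx κ Φ t p D) f) (hκ : (hL κ Φ t p D (gT mk gx κ Φ t p D) f).natAbs ≤ 10 * nL κ Φ t p D (gT mk gx κ Φ t p D) f)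
    {Rl : ℕ} (hRl : Rl ≤ RA' κ Φ t p D mk) (I : Fin 2) :
    (prFA κ Φ t p D (gT mk gx κ Φ t p D) f).kFF₂ (fcellsA κ Φ t p D (gT mk gx κ Φ t p D) f) Rl I +
        8 * (if Literature.Probability.Percolation.KozmaNitzan.Cells.oth I = 0 then u₀A κ Φ t p D (gT mk gx κ Φ t p D) f else u₁A κ Φ t p D (gT mk gx κ Φ t p D) f) + 8 ≤
      5 * ((fcellsA κ Φ t p D (gT mk gx κ Φ t p D) f).r (Literature.Probability.Percolation.KozmaNitzan.Cells.oth I) : ℤ) := by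
  have hq := kFF₂_le_linA κ Φ t p D f mk gx hN hκ Rl I
  obtain ⟨-, hu, hru⟩ := uA_oth_facts κ Φ t p D f mk gx hN hκ I
  have hRl' : (Rl : ℤ) ≤ RA' κ Φ t p D mk := by exact_mod_cast hRl
  have hR0 : (0 : ℤ) ≤ (Rl : ℤ) := Nat.cast_nonneg _
  set q := (prFA κ Φ t p D (gT mk gx κ Φ t p D) f).kFF₂ (fcellsA κ Φ t p D (gT mk gx κ Φ t p D) f) Rl I
  set u := (if Literature.Probability.Percolation.KozmaNitzan.Cells.oth I = 0 then u₀A κ Φ t p D (gT mk gx κ Φ t p D) f else u₁A κ Φ t p D (gT mk gx κ Φ t p D) f)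
  set r := ((fcellsA κ Φ t p D (gT mk gx κ Φ t p D) f).r (Literature.Probability.Percolation.KozmaNitzan.Cells.oth I) : ℤ)
  linarith

end Band

end KS

end NegB

end PlanarSkeletonFrm

end Summit.CriticalPhenomena.PercolationContinuityZ3.Theorems.Transplant

end
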